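import Mathlib
import Literature.NumberTheory.LFunctions.RHWave0PNTProofs
import Literature.Barriers.Parity.FordMaynardPrimeSievesProofs
import Literature.NumberTheory.Sieve.BrunGoldbach

/-!
# Bad moduli are harmonically sparse

Stub `stub_badModuliSparse` of the line `upward-replication-free-factorability` for the crux `EH`
(route `LiouvilleShiftedTables`, summit `Parity/GeneralizedHardyLittlewood`).

Fix `0 < ε'`, `0 < η` and a level exponent `θ` with `κ := 1 − ε' − θ > 0`.  A modulus `q ≤ x^θ` is
*bad* for a set `I ⊆ ℕ` when every prime `p ∤ q` of the window `(x^{1−ε'}/q, 2x^{1−ε'}/q]` has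
`q·p ∈ I`.  If `#I ≤ x^{1−ε'−η}` then `∑_{q bad} 1/φ(q) ≤ K x^{−η} (log x)²` for `x ≥ x₁`.

Proof (elementary counting + the prime number theorem):
* primes: with `P := x^{1−ε'}/q ≥ x^κ`, the window `(P, 2P]` contains `≥ P/(2 log 2P) ≥ P/(4 log x)`
  primes (`ϑ(2P) − ϑ(P) ≥ P/2` eventually, from `ϑ(x) ~ x`,
  `Literature.NumberTheory.LFunctions.chebyshevTheta_isEquivalent`, and
  `Literature.Barriers.Parity.FordMaynard.theta_sub_theta_le_card_primes_Ioc_mul_log`), of which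
  `≤ 2/κ` divide `q` (a positive integer `m ≤ x²` has `≤ 2/κ` prime factors `> x^κ`, their
  product dividing `m`); so each bad `q` has `≥ P/(5 log x)` admissible primes once
  `40 log x ≤ κ x^κ`;
* pairs: `(q, p) ↦ q·p ∈ I` has fibres of size `≤ 2/κ` (again: `p > x^κ` is a prime factor of
  `q·p ≤ 2x ≤ x²` and determines `q`), so `∑_{bad} #A(q) ≤ (2/κ)·#I ≤ (2/κ) x^{1−ε'−η}`;
* weights: `1/q ≤ (5 log x/x^{1−ε'})·#A(q)` and `q/φ(q) ≤ 3⁹ + 4e⁵ log log ⌊x⌋ ≤ (3⁹ + 4e⁵) log x`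
  (`Literature.NumberTheory.Sieve.BrunGoldbach.self_div_totient_le`), whence
  `∑_{bad} 1/φ(q) ≤ (10 (3⁹ + 4e⁵)/κ) · x^{−η} (log x)²`.

References: H. L. Montgomery, R. C. Vaughan, *Multiplicative Number Theory I*, CUP 2007, §8.1
(prime number theorem for `ϑ`), §2.3 (order of `n/φ(n)`).
-/

noncomputable section

open Filter Finset Real

namespace Summit.Parity.GeneralizedHardyLittlewood.Theorems.EH.BadModuliSparse

/-! ### Primes in a dyadic window, from the prime number theorem -/

/-- **Primes in `(P, 2P]`.** For all large `P`, `P/2 ≤ #{p prime : ⌊P⌋ < p ≤ ⌊2P⌋} · log (2P)`: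
`ϑ(⌊2P⌋) − ϑ(⌊P⌋) ≥ P/2` by the prime number theorem `ϑ(x) ~ x`, and each prime of the window
weighs at most `log (2P)`. [cite: MontgomeryVaughan2007, §8.1 eq. (8.3)] -/
theorem exists_window_primes : ∃ P₀ : ℝ, ∀ P : ℝ, P₀ ≤ P →
    P / 2 ≤ (((Finset.Ioc ⌊P⌋₊ ⌊2 * P⌋₊).filter Nat.Prime).card : ℝ) * Real.log (2 * P) := by
  have h := (Literature.NumberTheory.LFunctions.chebyshevTheta_isEquivalent.isLittleO).def
    (show (0 : ℝ) < 1 / 20 by norm_num)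
  obtain ⟨y₀, hy₀⟩ := Filter.eventually_atTop.1 h
  refine ⟨max y₀ 0 + 3, fun P hP => ?_⟩
  have hP3 : 3 ≤ P := le_trans (by linarith [le_max_right y₀ 0]) hP
  have hPy : y₀ + 3 ≤ P := le_trans (by linarith [le_max_left y₀ 0]) hP
  set s : ℕ := ⌊P⌋₊ with hs
  set t : ℕ := ⌊2 * P⌋₊ with ht
  have hsP : (s : ℝ) ≤ P := Nat.floor_le (by linarith)
  have hPs : P < s + 1 := Nat.lt_floor_add_one P
  have htP : (t : ℝ) ≤ 2 * P := Nat.floor_le (by linarith)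
  have hPt : 2 * P < t + 1 := Nat.lt_floor_add_one (2 * P)
  have hst : s ≤ t := Nat.floor_le_floor (by linarith)
  have h1 := Literature.Barriers.Parity.FordMaynard.theta_sub_theta_le_card_primes_Ioc_mul_log hst
  have h2 := hy₀ (s : ℝ) (by linarith)
  have h3 := hy₀ (t : ℝ) (by linarith)
  rw [Pi.sub_apply, Real.norm_eq_abs, Real.norm_eq_abs, Nat.abs_cast, abs_le] at h2 h3
  have ht0 : (0 : ℝ) < t := by linarith
  have hlog : Real.log t ≤ Real.log (2 * P) := Real.log_le_log ht0 htP
  calc P / 2 ≤ Chebyshev.theta t - Chebyshev.theta s := by linarith [h2.2, h3.1]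
    _ ≤ (((Finset.Ioc s t).filter Nat.Prime).card : ℝ) * Real.log t := h1
    _ ≤ (((Finset.Ioc s t).filter Nat.Prime).card : ℝ) * Real.log (2 * P) :=
        mul_le_mul_of_nonneg_left hlog (Nat.cast_nonneg _)

/-! ### Large prime factors -/

/-- The primes `> y` dividing `m ≠ 0` have product `∣ m`, so `y^{#} ≤ m`. [folklore] -/
theorem pow_card_filter_primeFactors_le {m : ℕ} (hm : m ≠ 0) {y : ℝ} (hy : 0 ≤ y) :
    y ^ (m.primeFactors.filter (fun p : ℕ => y < (p : ℝ))).card ≤ (m : ℝ) := by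
  set F := m.primeFactors.filter (fun p : ℕ => y < (p : ℝ)) with hF
  have hdvd : ∏ p ∈ F, p ∣ m :=
    (Finset.prod_dvd_prod_of_subset _ _ (fun p => p) (Finset.filter_subset _ _)).trans
      (Nat.prod_primeFactors_dvd m)
  have hle : ((∏ p ∈ F, p : ℕ) : ℝ) ≤ m := by
    exact_mod_cast Nat.le_of_dvd (Nat.pos_of_ne_zero hm) hdvd
  calc y ^ F.card = ∏ _p ∈ F, y := by rw [Finset.prod_const]
    _ ≤ ∏ p ∈ F, (p : ℝ) :=
        Finset.prod_le_prod (fun _ _ => hy) fun p hp => ((Finset.mem_filter.1 hp).2).le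
    _ = ((∏ p ∈ F, p : ℕ) : ℝ) := by push_cast; rfl
    _ ≤ m := hle

/-- A positive integer `m ≤ x²` (`x > 1`) has at most `2/κ` prime factors `> x^κ`. [folklore] -/
theorem card_filter_primeFactors_le {x κ : ℝ} (hx : 1 < x) (hκ : 0 < κ) {m : ℕ} (hm : m ≠ 0)
    (hmx : (m : ℝ) ≤ x ^ (2 : ℝ)) :
    ((m.primeFactors.filter (fun p : ℕ => x ^ κ < (p : ℝ))).card : ℝ) ≤ 2 / κ := by
  have h := pow_card_filter_primeFactors_le hm (Real.rpow_nonneg (by linarith : (0 : ℝ) ≤ x) κ)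
  rw [← Real.rpow_natCast, ← Real.rpow_mul (by linarith)] at h
  have h2 : κ * _ ≤ 2 := (Real.rpow_le_rpow_left_iff hx).1 (h.trans hmx)
  rw [le_div_iff₀ hκ]
  linarith [mul_comm κ ((m.primeFactors.filter (fun p : ℕ => x ^ κ < (p : ℝ))).card : ℝ)]

/-! ### Totients -/

/-- `1/φ(q) ≤ (3⁹ + 4e⁵) log x / q` for `1 ≤ q ≤ x`, `x ≥ 8`, `log x ≥ 1`, from
`q/φ(q) ≤ 3⁹ + 4e⁵ log log ⌊x⌋`. [cite: MontgomeryVaughan2007, §2.3 Theorem 2.9] -/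
theorem totient_inv_le {x : ℝ} (hx : 8 ≤ x) (hlog : 1 ≤ Real.log x) {q : ℕ} (hq : 1 ≤ q)
    (hqx : (q : ℝ) ≤ x) :
    ((Nat.totient q : ℝ))⁻¹ ≤ (3 ^ 9 + 4 * Real.exp 5) * Real.log x / q := by
  have hN : 8 ≤ ⌊x⌋₊ := Nat.le_floor (by exact_mod_cast hx)
  have hqN : q ≤ 2 * ⌊x⌋₊ := (Nat.le_floor hqx).trans (Nat.le_mul_of_pos_left _ two_pos)
  have h1 := Literature.NumberTheory.Sieve.BrunGoldbach.self_div_totient_le hq hqN hN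
  have hN1 : (1 : ℝ) < ⌊x⌋₊ := by exact_mod_cast (show 1 < ⌊x⌋₊ by omega)
  have hlogN : Real.log ⌊x⌋₊ ≤ Real.log x :=
    Real.log_le_log (by linarith) (Nat.floor_le (by linarith))
  have hloglog : Real.log (Real.log ⌊x⌋₊) ≤ Real.log x :=
    (Real.log_le_sub_one_of_pos (Real.log_pos hN1)).trans (by linarith)
  have hφ : (0 : ℝ) < q.totient := by exact_mod_cast Nat.totient_pos.2 hq
  have hq0 : (0 : ℝ) < q := by exact_mod_cast hq
  have h4 : 4 * Real.exp 5 * Real.log (Real.log ⌊x⌋₊) ≤ 4 * Real.exp 5 * Real.log x :=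
    mul_le_mul_of_nonneg_left hloglog (by positivity)
  have h9 : (3 : ℝ) ^ 9 ≤ 3 ^ 9 * Real.log x := by nlinarith
  rw [le_div_iff₀ hq0, inv_mul_eq_div]
  linarith

/-! ### Eventual inequalities -/

/-- The finitely many eventual inequalities in `x` used below (`log x = o(x^κ)`). [folklore] -/
theorem eventually_conds {κ : ℝ} (P₀ : ℝ) (hκ : 0 < κ) : ∀ᶠ x : ℝ in atTop,
    8 ≤ x ∧ 1 ≤ Real.log x ∧ P₀ ≤ x ^ κ ∧ 40 * Real.log x ≤ κ * x ^ κ := by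
  refine (eventually_ge_atTop 8).and ((Real.tendsto_log_atTop.eventually_ge_atTop 1).and
    (((tendsto_rpow_atTop hκ).eventually_ge_atTop P₀).and ?_))
  have h := (isLittleO_log_rpow_atTop hκ).def (show 0 < κ / 40 by positivity)
  filter_upwards [h, eventually_ge_atTop 1] with x hx hx1
  rw [Real.norm_eq_abs, Real.norm_eq_abs, abs_of_nonneg (Real.log_nonneg hx1),
    abs_of_nonneg (Real.rpow_nonneg (by linarith) κ)] at hx
  linarith

/-! ### The stub -/

/-- **Bad moduli are sparse** (stub `stub_badModuliSparse` of the line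
`upward-replication-free-factorability`, crux `EH`).  Call `q ≤ x^θ` bad for `I` when every prime
`p ∤ q` of `(x^{1−ε'}/q, 2x^{1−ε'}/q]` has `q·p ∈ I`.  If `#I ≤ x^{1−ε'−η}` and
`κ = 1 − ε' − θ > 0`, then `∑_{q bad} 1/φ(q) ≤ K x^{−η} (log x)²` for `x ≥ x₁`, with
`K = 10 (3⁹ + 4e⁵)/κ`: each bad `q` has `≥ x^{1−ε'}/(5 q log x)` admissible primes (prime number
theorem in `(P, 2P]` minus the `≤ 2/κ` prime factors of `q` exceeding `x^κ`), the map
`(q, p) ↦ q·p ∈ I` is at most `(2/κ)`-to-one, and `q/φ(q) ≤ (3⁹ + 4e⁵) log x`.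
[cite: MontgomeryVaughan2007, §8.1 eq. (8.3)] -/
theorem stub_badModuliSparse :
    ∀ ε' η θ : ℝ, 0 < ε' → 0 < η → 0 < 1 - ε' - θ →
      ∃ K x₁ : ℝ, ∀ x : ℝ, x₁ ≤ x → ∀ I : Finset ℕ, (I.card : ℝ) ≤ x ^ (1 - ε' - η) →
        ∀ Bad : Finset ℕ, Bad ⊆ Finset.Icc 1 ⌊x ^ θ⌋₊ →
          (∀ q ∈ Bad, ∀ p : ℕ, p.Prime → ¬ p ∣ q →
              x ^ (1 - ε') / q < p → (p : ℝ) ≤ 2 * x ^ (1 - ε') / q → q * p ∈ I) →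
            ∑ q ∈ Bad, ((Nat.totient q : ℝ))⁻¹ ≤ K * x ^ (-η) * Real.log x ^ 2 := by
  intro ε' η θ hε' hη hκ
  set κ := 1 - ε' - θ with hκdef
  set C : ℝ := 3 ^ 9 + 4 * Real.exp 5 with hCdef
  have hC0 : 0 < C := by positivity
  obtain ⟨P₀, hP₀⟩ := exists_window_primes
  obtain ⟨x₁, hx₁⟩ := Filter.eventually_atTop.1 (eventually_conds P₀ hκ)
  refine ⟨10 * C / κ, x₁, ?_⟩
  intro x hx I hI Bad hBad hmem
  obtain ⟨hx8, hlog1, hP₀x, hlogx⟩ := hx₁ x hx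
  set L := Real.log x with hLdef
  set X := x ^ (1 - ε') with hXdef
  have hx1 : 1 < x := by linarith
  have hL0 : 0 < L := by linarith
  have hX0 : 0 < X := Real.rpow_pos_of_pos (by linarith) _
  have hXx : X ≤ x := by
    simpa using Real.rpow_le_rpow_of_exponent_le hx1.le (by linarith : 1 - ε' ≤ 1)
  have hx2 : x ^ θ ≤ x ^ (2 : ℝ) := Real.rpow_le_rpow_of_exponent_le hx1.le (by linarith)
  have hxθ : x ^ θ ≤ x := by
    simpa using Real.rpow_le_rpow_of_exponent_le hx1.le (by linarith : θ ≤ 1)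
  -- the window primes of `q` and the admissible ones
  set Pr : ℕ → Finset ℕ := fun q => (Finset.Ioc ⌊X / q⌋₊ ⌊2 * (X / q)⌋₊).filter Nat.Prime
    with hPrdef
  set A : ℕ → Finset ℕ := fun q => (Pr q).filter (fun p => ¬ p ∣ q) with hAdef
  have hq : ∀ q ∈ Bad, 1 ≤ q ∧ (q : ℝ) ≤ x ^ θ := fun q hqB =>
    ⟨(Finset.mem_Icc.1 (hBad hqB)).1,
      (Nat.le_floor_iff (Real.rpow_nonneg (by linarith) θ)).1 (Finset.mem_Icc.1 (hBad hqB)).2⟩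
  have hPq : ∀ q ∈ Bad, x ^ κ ≤ X / q := by
    intro q hqB
    obtain ⟨hq1, hqθ⟩ := hq q hqB
    rw [le_div_iff₀ (by exact_mod_cast hq1 : (0 : ℝ) < q)]
    calc x ^ κ * q ≤ x ^ κ * x ^ θ := mul_le_mul_of_nonneg_left hqθ (Real.rpow_nonneg (by linarith) κ)
      _ = X := by rw [hXdef, ← Real.rpow_add (by linarith), hκdef]; ring_nf
  -- (1) each bad `q` has many admissible primes
  have key1 : ∀ q ∈ Bad, X / q ≤ 5 * L * ((A q).card : ℝ) := by
    intro q hqB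
    obtain ⟨hq1, hqθ⟩ := hq q hqB
    have hP := hPq q hqB
    have hq0 : (0 : ℝ) < q := by exact_mod_cast hq1
    have h1 := hP₀ (X / q) (hP₀x.trans hP)
    have h2 : Real.log (2 * (X / q)) ≤ 2 * L := by
      have hXq : X / q ≤ X := div_le_self hX0.le (by exact_mod_cast hq1)
      have h22 : 2 * (X / q) ≤ x ^ 2 := by nlinarith
      calc Real.log (2 * (X / q)) ≤ Real.log (x ^ 2) := Real.log_le_log (by positivity) h22
        _ = 2 * L := by rw [Real.log_pow]; push_cast; ring
    have h3 : X / q / 4 ≤ ((Pr q).card : ℝ) * L := by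
      have := mul_le_mul_of_nonneg_left h2 (Nat.cast_nonneg (Pr q).card)
      linarith
    have h4 : (((Pr q).filter (· ∣ q)).card : ℝ) ≤ 2 / κ := by
      have hsub : (Pr q).filter (· ∣ q) ⊆ q.primeFactors.filter (fun p : ℕ => x ^ κ < (p : ℝ)) := by
        intro p hp
        simp only [hPrdef, Finset.mem_filter, Finset.mem_Ioc] at hp
        obtain ⟨⟨⟨hp1, -⟩, hpp⟩, hpq⟩ := hp
        refine Finset.mem_filter.2 ⟨Nat.mem_primeFactors.2 ⟨hpp, hpq, by omega⟩, ?_⟩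
        exact hP.trans_lt (Nat.lt_of_floor_lt hp1)
      calc (((Pr q).filter (· ∣ q)).card : ℝ)
          ≤ ((q.primeFactors.filter (fun p : ℕ => x ^ κ < (p : ℝ))).card : ℝ) := by
            exact_mod_cast Finset.card_le_card hsub
        _ ≤ 2 / κ := card_filter_primeFactors_le hx1 hκ (by omega) (hqθ.trans hx2)
    have h5 : (((Pr q).filter (· ∣ q)).card : ℝ) + ((A q).card : ℝ) = ((Pr q).card : ℝ) := by
      exact_mod_cast Finset.card_filter_add_card_filter_not (s := Pr q) (· ∣ q)
    have h6 : 40 * L ≤ κ * (X / q) := hlogx.trans (mul_le_mul_of_nonneg_left hP hκ.le)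
    have h7 : (((Pr q).filter (· ∣ q)).card : ℝ) * L ≤ X / q / 20 := by
      have h71 : (((Pr q).filter (· ∣ q)).card : ℝ) * L ≤ 2 / κ * L :=
        mul_le_mul_of_nonneg_right h4 hL0.le
      have h72 : 2 / κ * L ≤ X / q / 20 := by
        rw [div_mul_eq_mul_div, div_le_iff₀ hκ]
        linarith
      linarith
    have h8 : ((Pr q).card : ℝ) * L =
        (((Pr q).filter (· ∣ q)).card : ℝ) * L + ((A q).card : ℝ) * L := by
      rw [← h5]; ring
    linarith
  -- (2) the pairs `(q, p)`, `p` admissible for `q`, inject `(2/κ)`-to-one into `I`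
  set S := Bad.sigma A with hSdef
  have hmaps : ∀ a ∈ S, (fun a : (Σ _ : ℕ, ℕ) => a.1 * a.2) a ∈ I := by
    rintro ⟨q, p⟩ ha
    simp only [hSdef, Finset.mem_sigma, hAdef, hPrdef, Finset.mem_filter, Finset.mem_Ioc] at ha
    obtain ⟨hqB, ⟨⟨hp1, hp2⟩, hpp⟩, hpq⟩ := ha
    obtain ⟨hq1, -⟩ := hq q hqB
    refine hmem q hqB p hpp hpq (Nat.lt_of_floor_lt hp1) ?_
    rw [mul_div_assoc]
    exact (Nat.le_floor_iff (by positivity)).1 hp2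
  have hfib : ∀ m ∈ I, (S.filter (fun a => a.1 * a.2 = m)).card ≤ ⌊2 / κ⌋₊ := by
    intro m _
    rcases (S.filter (fun a => a.1 * a.2 = m)).eq_empty_or_nonempty with h | ⟨⟨q₀, p₀⟩, h₀⟩
    · simp [h]
    simp only [hSdef, Finset.mem_filter, Finset.mem_sigma, hAdef, hPrdef, Finset.mem_Ioc] at h₀
    obtain ⟨⟨hqB, ⟨⟨-, hp2⟩, hpp⟩, -⟩, hm⟩ := h₀
    obtain ⟨hq1, -⟩ := hq q₀ hqB
    have hq0 : (0 : ℝ) < q₀ := by exact_mod_cast hq1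
    have hm0 : m ≠ 0 := by rw [← hm]; exact Nat.mul_ne_zero (by omega) hpp.ne_zero
    have hmx : (m : ℝ) ≤ x ^ (2 : ℝ) := by
      have hp2' : (p₀ : ℝ) ≤ 2 * (X / q₀) := (Nat.le_floor_iff (by positivity)).1 hp2
      have hmc : (m : ℝ) = q₀ * p₀ := by rw [← hm]; push_cast; ring
      rw [hmc, Real.rpow_two]
      calc (q₀ : ℝ) * p₀ ≤ q₀ * (2 * (X / q₀)) := mul_le_mul_of_nonneg_left hp2' hq0.le
        _ = 2 * X := by field_simp
        _ ≤ x ^ 2 := by nlinarith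
    have hinj : (S.filter (fun a => a.1 * a.2 = m)).card ≤
        (m.primeFactors.filter (fun p : ℕ => x ^ κ < (p : ℝ))).card := by
      refine Finset.card_le_card_of_injOn (fun a : (Σ _ : ℕ, ℕ) => a.2) ?_ ?_
      · rintro ⟨q, p⟩ ha
        simp only [Finset.coe_filter, Set.mem_setOf_eq, hSdef, Finset.mem_sigma, hAdef, hPrdef,
          Finset.mem_filter, Finset.mem_Ioc] at ha
        obtain ⟨⟨hqB', ⟨⟨hp1', -⟩, hpp'⟩, -⟩, hm'⟩ := ha
        simp only [Finset.coe_filter, Set.mem_setOf_eq]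
        exact ⟨Nat.mem_primeFactors.2 ⟨hpp', Dvd.intro_left q hm', hm0⟩,
          (hPq q hqB').trans_lt (Nat.lt_of_floor_lt hp1')⟩
      · rintro ⟨q, p⟩ ha ⟨q', p'⟩ ha' hpp
        simp only [Finset.coe_filter, Set.mem_setOf_eq, hSdef, Finset.mem_sigma, hAdef, hPrdef,
          Finset.mem_filter, Finset.mem_Ioc] at ha ha' hpp
        subst hpp
        have hp0 : 0 < p := ha.1.2.1.2.pos
        have hqq : q = q' := Nat.eq_of_mul_eq_mul_right hp0 (ha.2.trans ha'.2.symm)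
        subst hqq
        rfl
    refine Nat.le_floor ?_
    calc ((S.filter (fun a => a.1 * a.2 = m)).card : ℝ)
        ≤ ((m.primeFactors.filter (fun p : ℕ => x ^ κ < (p : ℝ))).card : ℝ) := by
          exact_mod_cast hinj
      _ ≤ 2 / κ := card_filter_primeFactors_le hx1 hκ hm0 hmx
  have hS : S.card ≤ ⌊2 / κ⌋₊ * I.card := Finset.card_le_mul_card_image_of_maps_to hmaps _ hfib
  have key2 : (∑ q ∈ Bad, ((A q).card : ℝ)) ≤ 2 / κ * x ^ (1 - ε' - η) := by
    have h1 : (∑ q ∈ Bad, ((A q).card : ℝ)) = S.card := by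
      rw [hSdef, Finset.card_sigma]; push_cast; rfl
    rw [h1]
    calc (S.card : ℝ) ≤ (⌊2 / κ⌋₊ : ℝ) * I.card := by exact_mod_cast hS
      _ ≤ 2 / κ * x ^ (1 - ε' - η) :=
          mul_le_mul (Nat.floor_le (by positivity)) hI (Nat.cast_nonneg _) (by positivity)
  -- (3) weights and totients
  have hterm : ∀ q ∈ Bad, ((Nat.totient q : ℝ))⁻¹ ≤ (5 * C * L ^ 2 / X) * ((A q).card : ℝ) := by
    intro q hqB
    obtain ⟨hq1, hqθ⟩ := hq q hqB
    have hq0 : (0 : ℝ) < q := by exact_mod_cast hq1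
    have h1 := totient_inv_le hx8 hlog1 hq1 (hqθ.trans hxθ)
    have h2 := key1 q hqB
    calc ((Nat.totient q : ℝ))⁻¹ ≤ C * L / q := h1
      _ = (C * L / X) * (X / q) := by field_simp
      _ ≤ (C * L / X) * (5 * L * ((A q).card : ℝ)) :=
          mul_le_mul_of_nonneg_left h2 (by positivity)
      _ = (5 * C * L ^ 2 / X) * ((A q).card : ℝ) := by ring
  have hXη : x ^ (1 - ε' - η) = X * x ^ (-η) := by
    rw [hXdef, ← Real.rpow_add (by linarith)]; ring_nf
  calc ∑ q ∈ Bad, ((Nat.totient q : ℝ))⁻¹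
      ≤ ∑ q ∈ Bad, (5 * C * L ^ 2 / X) * ((A q).card : ℝ) := Finset.sum_le_sum hterm
    _ = (5 * C * L ^ 2 / X) * ∑ q ∈ Bad, ((A q).card : ℝ) := by rw [Finset.mul_sum]
    _ ≤ (5 * C * L ^ 2 / X) * (2 / κ * x ^ (1 - ε' - η)) :=
        mul_le_mul_of_nonneg_left key2 (by positivity)
    _ = 10 * C / κ * x ^ (-η) * L ^ 2 := by
        rw [hXη]; field_simp; ring

end Summit.Parity.GeneralizedHardyLittlewood.Theorems.EH.BadModuliSparse

end
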